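import Literature.Probability.RandomPlanarGeometry.YangBaxterSAW
import Mathlib.Analysis.Convex.Hull
import HarnessLib

/-!
# The Yang–Baxter self-avoiding walk in a finite domain: its law as a random curve

Topic `Literature/Probability/RandomPlanarGeometry`; definition request `defn-YangBaxterSAW`
(route `CriticalPhenomena/SAWScalingLimit/SAWHexUniversality`, cruxes r4 `YBtoUniform` and r5
`YBUniversalityOfLimit`: "the chordal scaling limit … of the critical GM YB-weighted SAW is
independent of the angle sequence `Θ ∈ [π/3, 2π/3]^ℕ` … in every Dobrushin domain").

`YangBaxterSAW.lean` (item `defn-YangBaxterSAWWeights`) vendors the model of A. Glazman,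
I. Manolescu, *Self-avoiding walk on `ℤ²` with Yang–Baxter weights: universality of critical
fugacity and 2-point function*, Ann. Inst. Henri Poincaré Probab. Stat. 56 (2020), arXiv:1708.00395v3
(`GlazmanManolescu2019`), §1: the faces `Face = ℤ × ℤ` and mid-edges `MidEdge` of the columnar
rhombic tiling, the walks `YBWalk D a z` of a set of faces `D`, the local weights (1), the weight
`YBWalk.weight Θ γ = w_Θ(γ)`, the length `|γ|`, the half-plane/strip partition functions and
Theorems 1–3. The request asks in addition for **the finite-domain probability law, pushed to
`Literature.CurveClass ℂ`** — the object about which the route's cruxes r4/r5 speak ("in every Dobrushin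
domain"), i.e. the analogue for this model of `Literature.Probability.RandomPlanarGeometry.SAW.law`/`Literature.Probability.RandomPlanarGeometry.SAW.DomainSAW.curve`
(`SelfAvoidingWalk.lean`, `δℤ²`) and `Literature.Probability.RandomPlanarGeometry.SAW.hexSAWLaw`/`EmbDomainSAW.curve` (`HexSAW.lean`, `δℍ`).
This file provides it (namespace `Literature.SAW.YangBaxter`):

* `colOffset`, `planeCorner Θ f`, `planeMidpoint Θ e` — the embedding of the columnar rhombic
  tiling with angle sequence `Θ : ℤ → ℝ` of the WHOLE plane (column `k ∈ ℤ` made of unit rhombi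
  of upper-left angle `Θ k`; the paper tiles the right half-plane `H(Θ)`, p. 2, and remarks
  "One may more generally define the model on any rhombic tiling", p. 2; a bounded planar
  domain needs columns on both sides of the origin). On the faces of `H(Θ)` (`0 ≤ k`) these agree
  with `corner`/`midpoint` of `YangBaxterSAW.lean` (`planeCorner_eq_corner`,
  `planeMidpoint_eq_midpoint`).
* `cornerSet Θ f`, `rhombus Θ f` — the four corners and the closed rhombus (their convex hull) of
  the face `f`.
* `meshFaces Θ Ω δ : Set Face` — the discretisation `Ω_δ` of a planar domain `Ω ⊆ ℂ` at mesh
  `δ`: the faces whose rescaled closed rhombus `δ · rhombus Θ f` lies in `Ω`.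
* **`YangBaxterSAW Θ Ω δ a b`** — the Yang–Baxter self-avoiding walks of `Ω_δ` from the mid-edge
  `a` to the mid-edge `b` (`= YBWalk (meshFaces Θ Ω δ) a b`), with the discrete σ-algebra;
  `YBWalk.points`, `YBWalk.path`, **`YBWalk.curve Θ δ γ : CurveClass ℂ`** — the walk drawn as the
  polyline through the rescaled midpoints `δ · planeMidpoint Θ zᵢ` of the mid-edges it crosses,
  modulo reparametrisation;
* **`ybWeight Θ Ω δ x a b`** — the measure `γ ↦ w_Θ(γ) x^{|γ|}` on `YangBaxterSAW Θ Ω δ a b`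
  (eq. (4) of the paper with no surface fugacity, `y = 1`), and **`ybLaw Θ Ω δ x a b`**, its
  normalisation to a probability measure — the finite-domain law. "The weights (1) may be
  considered critical for the weighted model" (p. 3, after [Gla15]): the *critical* law is
  `x = 1` (at `Θ ≡ π/3` the weight `w_Θ(γ)` is already `x_c^{|γ|}`, `x_c = 1/√(2+√2)`, p. 3).
* `IsYBEndpointApprox Θ D a b` — hypothesis structure for mesh-dependent endpoints
  `a δ, b δ : MidEdge` approximating the marked points of a Dobrushin domain `D` (as
  `Literature.Probability.RandomPlanarGeometry.SAW.IsEndpointApprox`).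

With these, "the law of the critical Yang–Baxter walk in `(Ω; a, b)` converges to chordal
SLE_κ" is the term
`ConvergesInLawToSLE κ D (fun δ (γ : YangBaxterSAW Θ D.carrier δ (a δ) (b δ)) => γ.curve Θ δ)
  (fun δ => ybLaw Θ D.carrier δ 1 (a δ) (b δ))`
(type-checked in the scratch file of the item; not asserted anywhere in the source, hence not
defined here as a named statement).

## Design choices

* Faces of `Ω_δ` are those whose CLOSED rescaled rhombus lies in `Ω`; since every arc of a walk
  is drawn inside a rhombus of the domain, the drawn curve of a walk with at least one arc lies
  in `Ω` (`YBWalk.range_path_subset`). No "largest connected component" is taken (unlike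
  `meshDomain` for `δℤ²`): the law from `a` to `b` only involves the walks joining them, and the
  endpoints are quantified through `IsYBEndpointApprox` anyway.
* The paper's arcs are smooth curves meeting the edges perpendicularly (p. 2); we draw the arc
  between two sides of a rhombus as the straight segment between their midpoints, which lies in
  the same closed rhombus (`segment_subset_rhombus_of_arcFace`); the two drawings of a walk are
  at uniform distance at most the diameter `< 2δ` of a rescaled rhombus, so they have the same
  scaling limits in `CurveClass ℂ`.
* Weights are clamped to `ℝ≥0∞` by `ENNReal.ofReal` as in `YangBaxterSAW.lean` (no clamping
  occurs for `Θ k ∈ [π/3, 2π/3]`, `x ≥ 0`, where all local weights are `≥ 0`, p. 2). `ybLaw` has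
  the junk value `0` if there is no walk from `a` to `b` in `Ω_δ` or if the total weight is
  infinite (impossible for bounded `Ω` and `δ > 0`, when `meshFaces` and hence the set of walks
  is finite).
* Mathlib/tree search: no prior finite-domain Yang–Baxter walk measure (`lean search
  'YangBaxter'`, `'meshFaces'`, `'rhombus'`); the isoradial vocabulary
  `Literature.Probability.LatticeModels.RhombicEmbedding` (`LatticeModels/IsoradialGraphs.lean`) is about rhombic
  embeddings of general planar graphs and is not needed for the explicit columnar tiling.
-/

noncomputable section

open MeasureTheory Filter Topology Literature.Probability.LatticeModels Literature.Probability.Percolation Real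
open scoped NNReal ENNReal

namespace Literature.Probability.RandomPlanarGeometry.SAW.YangBaxter

open MidEdge
open Complex (I)

/-! ### The columnar rhombic tiling of the whole plane -/

/-- The horizontal offset of column `k ∈ ℤ`: the sum of the side vectors `colShift Θ i` of the
columns `0 ≤ i < k` if `k ≥ 0`, minus the sum over the columns `k ≤ i < 0` if `k < 0` (so that
`colOffset Θ (k + 1) = colOffset Θ k + colShift Θ k` for every `k`, `colOffset_add_one`).
[cite: GlazmanManolescu2019, §1 (H(Θ)); p. 2 ("One may more generally define the model on any rhombic tiling")] -/
def colOffset (Θ : ℤ → ℝ) (k : ℤ) : ℂ :=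
  (∑ i ∈ Finset.range k.toNat, colShift Θ i) -
    ∑ i ∈ Finset.range (-k).toNat, colShift Θ (-1 - (i : ℤ))

/-- The lower-left corner of the rhombus `(k, j)` of the columnar tiling of the whole plane with
angle sequence `Θ : ℤ → ℝ` (column `k` made of unit rhombi of upper-left angle `Θ k`, vertical
sides, row `j` shifted up by `j`), normalised so that the origin is the midpoint of the vertical
edge `vert 0 0`; extends `corner` (columns `k ≥ 0`) to the left half-plane.
[cite: GlazmanManolescu2019, §1 (H(Θ)); p. 2 ("One may more generally define the model on any rhombic tiling")] -/
def planeCorner (Θ : ℤ → ℝ) (f : Face) : ℂ :=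
  (f.2 : ℂ) * I - I / 2 + colOffset Θ f.1

/-- The midpoint of the edge `e` in the whole-plane tiling (extends `midpoint`).
[cite: GlazmanManolescu2019, §1] -/
def planeMidpoint (Θ : ℤ → ℝ) : MidEdge → ℂ
  | .vert k j => planeCorner Θ (k, j) + I / 2
  | .slant k j => planeCorner Θ (k, j) + colShift Θ k / 2

/-- The four corners of the rhombus `f`: lower-left `c`, upper-left `c + i`, lower-right
`c + colShift`, upper-right `c + i + colShift`. [cite: GlazmanManolescu2019, §1] -/
def cornerSet (Θ : ℤ → ℝ) (f : Face) : Set ℂ :=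
  {planeCorner Θ f, planeCorner Θ f + I, planeCorner Θ f + colShift Θ f.1,
    planeCorner Θ f + I + colShift Θ f.1}

/-- The closed rhombus of the face `f` (convex hull of its four corners), a subset of the plane.
[cite: GlazmanManolescu2019, §1] -/
def rhombus (Θ : ℤ → ℝ) (f : Face) : Set ℂ :=
  convexHull ℝ (cornerSet Θ f)

/-! ### Discretisation of a planar domain; the walks of `Ω_δ` -/

/-- The faces of the discrete domain `Ω_δ`: the rhombi `f` whose rescaled closed rhombus
`δ · rhombus Θ f` lies in `Ω`. [folklore] -/
def meshFaces (Θ : ℤ → ℝ) (Ω : Set ℂ) (δ : ℝ) : Set Face :=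
  {f | ∀ z ∈ rhombus Θ f, (δ : ℂ) * z ∈ Ω}

/-- Membership in `meshFaces`, unfolded. [folklore] -/
theorem mem_meshFaces_iff {Θ : ℤ → ℝ} {Ω : Set ℂ} {δ : ℝ} {f : Face} :
    f ∈ meshFaces Θ Ω δ ↔ ∀ z ∈ rhombus Θ f, (δ : ℂ) * z ∈ Ω := Iff.rfl

/-- `meshFaces` is monotone in the domain. [folklore] -/
theorem meshFaces_mono (Θ : ℤ → ℝ) {Ω Ω' : Set ℂ} (h : Ω ⊆ Ω') (δ : ℝ) :
    meshFaces Θ Ω δ ⊆ meshFaces Θ Ω' δ :=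
  fun _ hf z hz => h (hf z hz)

/-- Every face belongs to the discretisation of the whole plane. [folklore] -/
@[simp] theorem meshFaces_univ (Θ : ℤ → ℝ) (δ : ℝ) : meshFaces Θ Set.univ δ = Set.univ :=
  Set.eq_univ_of_forall fun _ _ _ => Set.mem_univ _

/-- **The Yang–Baxter self-avoiding walks of the discrete domain `Ω_δ` from `a` to `b`**
(Glazman–Manolescu's walks — "a simple curve `γ` starting and ending at midpoints of edges,
intersecting edges at right angles and traversing each rhombus in one of the ways depicted in
Fig. 1" — all of whose arcs are drawn in rhombi of `Ω_δ = meshFaces Θ Ω δ`).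
[cite: GlazmanManolescu2019, §1 (definition of the model); p. 2 ("One may more generally define the model on any rhombic tiling")] -/
abbrev YangBaxterSAW (Θ : ℤ → ℝ) (Ω : Set ℂ) (δ : ℝ) (a b : MidEdge) : Type :=
  YBWalk (meshFaces Θ Ω δ) a b

namespace YBWalk

variable {D : Set Face} {a z : MidEdge}

/-- Discrete σ-algebra on the set of walks (finite for a finite set of faces). [folklore] -/
instance : MeasurableSpace (YBWalk D a z) := ⊤

/-- Every map out of the space of walks is measurable (discrete σ-algebra). [folklore] -/
theorem measurable_of_top {β : Type*} [MeasurableSpace β] (f : YBWalk D a z → β) :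
    Measurable f :=
  fun _ _ => MeasurableSpace.measurableSet_top

/-- The rescaled midpoints `δ · planeMidpoint Θ zᵢ` of the mid-edges crossed by the walk, in
order. [cite: GlazmanManolescu2019, §1] -/
def points (Θ : ℤ → ℝ) (δ : ℝ) (γ : YBWalk D a z) : List ℂ :=
  γ.mids.map fun e => (δ : ℂ) * planeMidpoint Θ e

/-- The walk drawn at mesh `δ`: the polyline through the rescaled midpoints of the mid-edges it
crosses (each segment inside the rescaled rhombus carrying the corresponding arc).
[cite: GlazmanManolescu2019, §1 ("a simple curve γ starting and ending at midpoints of edges")] -/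
def path (Θ : ℤ → ℝ) (δ : ℝ) (γ : YBWalk D a z) : C(unitInterval, ℂ) :=
  polyline (γ.points Θ δ)

/-- **The walk as a random-curve sample point**: its drawing at mesh `δ` modulo
reparametrisation, in `CurveClass ℂ`. [cite: GlazmanManolescu2019, §1] -/
def curve (Θ : ℤ → ℝ) (δ : ℝ) (γ : YBWalk D a z) : CurveClass ℂ :=
  CurveClass.mk ⟨γ.path Θ δ⟩

end YBWalk

/-! ### The finite-domain weight and law -/

/-- **The Yang–Baxter SAW measure of `Ω_δ` from `a` to `b` at fugacity `x`**: the walk `γ` gets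
mass `w_Θ(γ) · x^{|γ|}` (eq. (4) with `y = 1`; `x = 1` gives the critical weights (1)). A sum of
weighted Dirac masses, values clamped to `ℝ≥0∞`.
[cite: GlazmanManolescu2019, §1, eq. (4); p. 3 ("the weights (1) may be considered critical")] -/
def ybWeight (Θ : ℤ → ℝ) (Ω : Set ℂ) (δ : ℝ) (x : ℝ) (a b : MidEdge) :
    Measure (YangBaxterSAW Θ Ω δ a b) :=
  Measure.sum fun γ => ENNReal.ofReal (γ.weight Θ * x ^ (γ.length Θ)) • Measure.dirac γ

/-- **The law of the Yang–Baxter SAW from `a` to `b` in `Ω_δ` at fugacity `x`**: the probability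
measure `P(γ) = w_Θ(γ) x^{|γ|} / Z`, `Z = Σ_γ w_Θ(γ) x^{|γ|}` (junk value `0` if `Z = 0` or `Z = ∞`).
The critical law of the route's cruxes is `x = 1`.
[cite: GlazmanManolescu2019, §1, eq. (4); p. 3 ("the weights (1) may be considered critical")] -/
def ybLaw (Θ : ℤ → ℝ) (Ω : Set ℂ) (δ : ℝ) (x : ℝ) (a b : MidEdge) :
    Measure (YangBaxterSAW Θ Ω δ a b) :=
  (ybWeight Θ Ω δ x a b Set.univ)⁻¹ • ybWeight Θ Ω δ x a b

/-- Hypothesis structure: **the mid-edges `a δ, b δ` approximate the marked boundary points of the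
Dobrushin domain `D = (Ω; a, b)`** along `δ → 0⁺`: for all small `δ > 0` there is a walk of `Ω_δ`
from `a δ` to `b δ`, and the rescaled midpoints converge to `a = D.pt 0`, `b = D.pt 1` (as
`Literature.Probability.RandomPlanarGeometry.SAW.IsEndpointApprox` for `δℤ²`). [folklore] -/
structure IsYBEndpointApprox (Θ : ℤ → ℝ) (D : DobrushinDomain) (a b : ℝ → MidEdge) : Prop where
  /-- for small `δ > 0` there are walks from `a δ` to `b δ` in `Ω_δ` -/
  nonempty : ∀ᶠ δ in 𝓝[>] (0 : ℝ), Nonempty (YangBaxterSAW Θ D.carrier δ (a δ) (b δ))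
  /-- `δ · a δ → a` -/
  tendsto_fst : Tendsto (fun δ : ℝ => (δ : ℂ) * planeMidpoint Θ (a δ)) (𝓝[>] (0 : ℝ)) (𝓝 (D.pt 0))
  /-- `δ · b δ → b` -/
  tendsto_snd : Tendsto (fun δ : ℝ => (δ : ℂ) * planeMidpoint Θ (b δ)) (𝓝[>] (0 : ℝ)) (𝓝 (D.pt 1))

/-! ### API: the embedding -/

/-- Column `0` has offset `0`. [folklore] -/
@[simp] theorem colOffset_zero (Θ : ℤ → ℝ) : colOffset Θ 0 = 0 := by
  simp [colOffset]

/-- For `k ≥ 0` the offset is the sum of the side vectors of the columns `0, …, k-1`. [folklore] -/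
theorem colOffset_of_nonneg (Θ : ℤ → ℝ) {k : ℤ} (hk : 0 ≤ k) :
    colOffset Θ k = ∑ i ∈ Finset.range k.toNat, colShift Θ i := by
  have : (-k).toNat = 0 := Int.toNat_eq_zero.mpr (neg_nonpos.mpr hk)
  simp [colOffset, this]

/-- Adjacent columns glue: `colOffset Θ (k + 1) = colOffset Θ k + colShift Θ k` for every `k ∈ ℤ`.
[folklore] -/
theorem colOffset_add_one (Θ : ℤ → ℝ) (k : ℤ) :
    colOffset Θ (k + 1) = colOffset Θ k + colShift Θ k := by
  rcases le_or_gt 0 k with hk | hk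
  · lift k to ℕ using hk
    have h1 : ((k : ℤ) + 1).toNat = k + 1 := by omega
    have h2 : (-((k : ℤ) + 1)).toNat = 0 := by omega
    have h3 : (-(k : ℤ)).toNat = 0 := by omega
    rw [colOffset, colOffset, h1, h2, h3, Int.toNat_natCast, Finset.sum_range_succ,
      Finset.sum_range_zero]
    ring
  · obtain ⟨m, rfl⟩ := Int.eq_negSucc_of_lt_zero hk
    have h1 : (Int.negSucc m + 1 : ℤ) = -(m : ℤ) := by rw [Int.negSucc_eq]; ring
    have h2 : (-Int.negSucc m : ℤ) = ((m + 1 : ℕ) : ℤ) := by rw [Int.negSucc_eq]; push_cast; ring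
    have h3 : (-(m : ℤ)).toNat = 0 := Int.toNat_eq_zero.mpr (by omega)
    have h4 : (-1 - (m : ℤ)) = Int.negSucc m := by rw [Int.negSucc_eq]; ring
    rw [colOffset, colOffset, h1, h2, neg_neg, Int.toNat_natCast, Int.toNat_natCast, h3,
      Int.toNat_negSucc, Finset.sum_range_zero, Finset.sum_range_succ, h4]
    ring

/-- Moving one column to the right adds the side vector of the column. [folklore] -/
theorem planeCorner_add_one_fst (Θ : ℤ → ℝ) (k j : ℤ) :
    planeCorner Θ (k + 1, j) = planeCorner Θ (k, j) + colShift Θ k := by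
  simp only [planeCorner, colOffset_add_one]
  ring

/-- Moving one row up adds `i`. [folklore] -/
theorem planeCorner_add_one_snd (Θ : ℤ → ℝ) (k j : ℤ) :
    planeCorner Θ (k, j + 1) = planeCorner Θ (k, j) + I := by
  simp only [planeCorner, Int.cast_add, Int.cast_one]
  ring

/-- On the right half-plane `H(Θ)` the whole-plane corner is the corner of `YangBaxterSAW.lean`.
[cite: GlazmanManolescu2019, §1] -/
theorem planeCorner_eq_corner (Θ : ℤ → ℝ) {f : Face} (hf : 0 ≤ f.1) :
    planeCorner Θ f = corner Θ f := by
  rw [planeCorner, corner, colOffset_of_nonneg Θ hf]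

/-- On the edges of `H(Θ)` (edges of a face of column `≥ 0`) the whole-plane midpoint is the
midpoint of `YangBaxterSAW.lean`. [cite: GlazmanManolescu2019, §1] -/
theorem planeMidpoint_eq_midpoint (Θ : ℤ → ℝ) {e : MidEdge} (he : 0 ≤ e.faces.2.1) :
    planeMidpoint Θ e = midpoint Θ e := by
  cases e with
  | vert k j => simp [planeMidpoint, midpoint, planeCorner_eq_corner Θ (f := (k, j)) he]
  | slant k j => simp [planeMidpoint, midpoint, planeCorner_eq_corner Θ (f := (k, j)) he]

/-- The origin is embedded at `0 ∈ ℂ`. [cite: GlazmanManolescu2019, §1] -/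
@[simp] theorem planeMidpoint_origin (Θ : ℤ → ℝ) : planeMidpoint Θ origin = 0 := by
  simp [planeMidpoint, origin, planeCorner]

/-- The rhombus is convex. [folklore] -/
theorem convex_rhombus (Θ : ℤ → ℝ) (f : Face) : Convex ℝ (rhombus Θ f) :=
  convex_convexHull ℝ _

/-- The corners belong to the rhombus. [folklore] -/
theorem cornerSet_subset_rhombus (Θ : ℤ → ℝ) (f : Face) : cornerSet Θ f ⊆ rhombus Θ f :=
  subset_convexHull ℝ _

/-- The midpoint of two corners belongs to the rhombus. [folklore] -/
theorem mem_rhombus_of_eq_midpoint (Θ : ℤ → ℝ) (f : Face) {w p q : ℂ} (hp : p ∈ cornerSet Θ f)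
    (hq : q ∈ cornerSet Θ f) (h : w = (1 / 2 : ℝ) • p + (1 / 2 : ℝ) • q) : w ∈ rhombus Θ f := by
  rw [h]
  exact convex_rhombus Θ f (cornerSet_subset_rhombus Θ f hp) (cornerSet_subset_rhombus Θ f hq)
    (by norm_num) (by norm_num) (by norm_num)

/-- The midpoint of each side of a rhombus lies in the (closed) rhombus.
[cite: GlazmanManolescu2019, §1] -/
theorem planeMidpoint_side_mem_rhombus (Θ : ℤ → ℝ) (f : Face) (s : Side) :
    planeMidpoint Θ (f.side s) ∈ rhombus Θ f := by
  obtain ⟨k, j⟩ := f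
  cases s with
  | W =>
    refine mem_rhombus_of_eq_midpoint Θ (k, j) (p := planeCorner Θ (k, j))
      (q := planeCorner Θ (k, j) + I) (by simp [cornerSet]) (by simp [cornerSet]) ?_
    simp only [Face.side, planeMidpoint, Complex.real_smul]
    push_cast
    ring
  | E =>
    refine mem_rhombus_of_eq_midpoint Θ (k, j) (p := planeCorner Θ (k, j) + colShift Θ k)
      (q := planeCorner Θ (k, j) + I + colShift Θ k) (by simp [cornerSet]) (by simp [cornerSet]) ?_
    simp only [Face.side, planeMidpoint, planeCorner_add_one_fst, Complex.real_smul]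
    push_cast
    ring
  | S =>
    refine mem_rhombus_of_eq_midpoint Θ (k, j) (p := planeCorner Θ (k, j))
      (q := planeCorner Θ (k, j) + colShift Θ k) (by simp [cornerSet]) (by simp [cornerSet]) ?_
    simp only [Face.side, planeMidpoint, Complex.real_smul]
    push_cast
    ring
  | N =>
    refine mem_rhombus_of_eq_midpoint Θ (k, j) (p := planeCorner Θ (k, j) + I)
      (q := planeCorner Θ (k, j) + I + colShift Θ k) (by simp [cornerSet]) (by simp [cornerSet]) ?_
    simp only [Face.side, planeMidpoint, planeCorner_add_one_snd, Complex.real_smul]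
    push_cast
    ring

/-- A mid-edge is the East, resp. North side of the first face it borders and the West, resp.
South side of the second. [folklore] -/
theorem eq_side_faces (e : MidEdge) :
    (e = e.faces.1.side .E ∨ e = e.faces.1.side .N) ∧ (e = e.faces.2.side .W ∨ e = e.faces.2.side .S) := by
  cases e with
  | vert k j => exact ⟨Or.inl (by simp [MidEdge.faces, Face.side]), Or.inl rfl⟩
  | slant k j => exact ⟨Or.inr (by simp [MidEdge.faces, Face.side]), Or.inr rfl⟩

/-- The midpoint of a mid-edge lies in the rhombi of both faces it borders. [folklore] -/
theorem planeMidpoint_mem_rhombus_faces (Θ : ℤ → ℝ) (e : MidEdge) :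
    planeMidpoint Θ e ∈ rhombus Θ e.faces.1 ∧ planeMidpoint Θ e ∈ rhombus Θ e.faces.2 := by
  have key : ∀ (f : Face) (s : Side), e = f.side s → planeMidpoint Θ e ∈ rhombus Θ f :=
    fun f s h => by rw [h]; exact planeMidpoint_side_mem_rhombus Θ f s
  obtain ⟨h1, h2⟩ := eq_side_faces e
  exact ⟨h1.elim (key _ _) (key _ _), h2.elim (key _ _) (key _ _)⟩

/-- A common face of two mid-edges borders both. [folklore] -/
theorem eq_faces_of_commonFace {e e' : MidEdge} {f : Face} (h : commonFace e e' = some f) :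
    (f = e.faces.1 ∨ f = e.faces.2) ∧ (f = e'.faces.1 ∨ f = e'.faces.2) := by
  unfold commonFace at h
  split_ifs at h with h0 h1 h2
  · obtain rfl := Option.some.inj h
    exact ⟨Or.inl rfl, h1⟩
  · obtain rfl := Option.some.inj h
    exact ⟨Or.inr rfl, h2⟩

/-- Both ends of an arc drawn in the face `f` have their midpoints in the rhombus `f`.
[cite: GlazmanManolescu2019, §1] -/
theorem planeMidpoint_mem_rhombus_of_arcFace (Θ : ℤ → ℝ) {p : MidEdge × MidEdge} {f : Face}
    (h : arcFace p = some f) :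
    planeMidpoint Θ p.1 ∈ rhombus Θ f ∧ planeMidpoint Θ p.2 ∈ rhombus Θ f := by
  obtain ⟨h1, h2⟩ := eq_faces_of_commonFace h
  have m1 := planeMidpoint_mem_rhombus_faces Θ p.1
  have m2 := planeMidpoint_mem_rhombus_faces Θ p.2
  constructor
  · rcases h1 with rfl | rfl
    exacts [m1.1, m1.2]
  · rcases h2 with rfl | rfl
    exacts [m2.1, m2.2]

/-- The straight drawing of an arc (segment between the midpoints of its end-sides) lies in the
closed rhombus carrying it. [cite: GlazmanManolescu2019, §1] -/
theorem segment_subset_rhombus_of_arcFace (Θ : ℤ → ℝ) {p : MidEdge × MidEdge} {f : Face}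
    (h : arcFace p = some f) :
    segment ℝ (planeMidpoint Θ p.1) (planeMidpoint Θ p.2) ⊆ rhombus Θ f :=
  (convex_rhombus Θ f).segment_subset (planeMidpoint_mem_rhombus_of_arcFace Θ h).1
    (planeMidpoint_mem_rhombus_of_arcFace Θ h).2

/-- The rescaled drawing of an arc carried by a face of `Ω_δ` lies in `Ω`. [folklore] -/
theorem segment_subset_of_arc_mem {Θ : ℤ → ℝ} {Ω : Set ℂ} {δ : ℝ} {p : MidEdge × MidEdge}
    (h : ∃ f ∈ meshFaces Θ Ω δ, arcFace p = some f) :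
    segment ℝ ((δ : ℂ) * planeMidpoint Θ p.1) ((δ : ℂ) * planeMidpoint Θ p.2) ⊆ Ω := by
  obtain ⟨f, hf, hpf⟩ := h
  rintro _ ⟨s, t, hs, ht, hst, rfl⟩
  have hm := planeMidpoint_mem_rhombus_of_arcFace Θ hpf
  have hz : s • planeMidpoint Θ p.1 + t • planeMidpoint Θ p.2 ∈ rhombus Θ f :=
    convex_rhombus Θ f hm.1 hm.2 hs ht hst
  have := hf _ hz
  convert this using 1
  simp only [Complex.real_smul, mul_add]
  ring

/-! ### API: polylines stay where their segments are -/

section Polyline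

variable {E : Type*} [AddCommGroup E] [Module ℝ E] [TopologicalSpace E] [ContinuousAdd E]
  [ContinuousSMul ℝ E]

/-- If every segment between consecutive points of `a :: l` lies in `S` (and `a ∈ S`), the
polyline from `a` through `l` lies in `S`. [folklore] -/
theorem range_polylineFrom_subset {S : Set E} (a : E) (l : List E) (ha : a ∈ S)
    (h : (a :: l).IsChain fun p q => segment ℝ p q ⊆ S) :
    Set.range (polylineFrom a l).2 ⊆ S := by
  induction l generalizing a with
  | nil =>
    rintro _ ⟨t, rfl⟩
    exact ha
  | cons b l ih =>
    rw [List.isChain_cons_cons] at h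
    rw [polylineFrom_cons, Path.trans_range, Set.union_subset_iff, Path.range_segment]
    exact ⟨h.1, ih b (h.1 (right_mem_segment ℝ a b)) h.2⟩

/-- A relation holding on all consecutive pairs (`l.zip l.tail`) is a chain. [folklore] -/
theorem isChain_of_forall_mem_zip {α : Type*} {R : α → α → Prop} :
    ∀ l : List α, (∀ p ∈ l.zip l.tail, R p.1 p.2) → l.IsChain R
  | [], _ => List.IsChain.nil
  | [a], _ => List.IsChain.singleton a
  | a :: b :: l, h =>
    List.IsChain.cons_cons (h (a, b) (by simp))
      (isChain_of_forall_mem_zip (b :: l) fun p hp => h p (by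
        simp only [List.tail_cons, List.zip_cons_cons, List.mem_cons]
        exact Or.inr (by simpa using hp)))

end Polyline

namespace YBWalk

variable {Θ : ℤ → ℝ} {Ω : Set ℂ} {δ : ℝ} {a b : MidEdge}

/-- **A walk of `Ω_δ` with at least one arc is drawn inside `Ω`.** [folklore] -/
theorem range_path_subset (γ : YangBaxterSAW Θ Ω δ a b) (h : γ.arcs ≠ []) :
    Set.range (γ.path Θ δ) ⊆ Ω := by
  have hchain : γ.mids.IsChain fun e e' =>
      segment ℝ ((δ : ℂ) * planeMidpoint Θ e) ((δ : ℂ) * planeMidpoint Θ e') ⊆ Ω :=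
    isChain_of_forall_mem_zip γ.mids fun p hp => segment_subset_of_arc_mem (γ.arc_mem p hp)
  have hmap : (γ.points Θ δ).IsChain fun p q => segment ℝ p q ⊆ Ω := by
    rw [points, List.isChain_map]
    exact hchain
  simp only [YBWalk.arcs, arcsOf] at h
  unfold path
  generalize hl : γ.mids = l at h hmap
  rcases l with _ | ⟨e, _ | ⟨e', l⟩⟩
  · simp at h
  · simp at h
  · simp only [points, hl, List.map_cons, List.isChain_cons_cons] at hmap
    have key := range_polylineFrom_subset (S := Ω) ((δ : ℂ) * planeMidpoint Θ e)
      (((δ : ℂ) * planeMidpoint Θ e') :: l.map fun e => (δ : ℂ) * planeMidpoint Θ e)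
      (hmap.1 (left_mem_segment ℝ _ _)) (List.isChain_cons_cons.2 hmap)
    rintro _ ⟨t, rfl⟩
    simp only [points, hl, List.map_cons, polyline]
    exact key (Set.mem_range_self t)

/-- The drawn walk starts at the rescaled midpoint of `a`. [cite: GlazmanManolescu2019, §1] -/
theorem path_apply_zero (γ : YangBaxterSAW Θ Ω δ a b) :
    γ.path Θ δ 0 = (δ : ℂ) * planeMidpoint Θ a := by
  have h := γ.head_eq
  unfold path points
  generalize hl : γ.mids = l at h
  rcases l with _ | ⟨e, l⟩
  · simp at h
  · simp only [List.head?_cons, Option.some.injEq] at h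
    subst h
    rw [List.map_cons, polyline_apply_zero]

/-- The observable `γ ↦ γ.curve` is measurable (discrete σ-algebra), so the measurability clause
of `ConvergesInLawToSLE` is automatic. [folklore] -/
theorem aemeasurable_curve (Θ : ℤ → ℝ) (Ω : Set ℂ) (δ x : ℝ) (a b : MidEdge) :
    AEMeasurable (fun γ : YangBaxterSAW Θ Ω δ a b => γ.curve Θ δ) (ybLaw Θ Ω δ x a b) :=
  (measurable_of_top _).aemeasurable

end YBWalk

/-! ### API: the measures -/

/-- The weight of a single walk is `w_Θ(γ) x^{|γ|}`. [cite: GlazmanManolescu2019, eq. (4)] -/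
theorem ybWeight_singleton {Θ : ℤ → ℝ} {Ω : Set ℂ} {δ : ℝ} (x : ℝ) {a b : MidEdge}
    (γ : YangBaxterSAW Θ Ω δ a b) :
    ybWeight Θ Ω δ x a b {γ} = ENNReal.ofReal (γ.weight Θ * x ^ (γ.length Θ)) := by
  rw [ybWeight, Measure.sum_apply _ MeasurableSpace.measurableSet_top, tsum_eq_single γ]
  · simp
  · intro γ' hγ'
    simp [hγ']

/-- The total weight (partition function of `Ω_δ` from `a` to `b`) is the sum of the weights.
[cite: GlazmanManolescu2019, §1] -/
theorem ybWeight_univ (Θ : ℤ → ℝ) (Ω : Set ℂ) (δ x : ℝ) (a b : MidEdge) :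
    ybWeight Θ Ω δ x a b Set.univ =
      ∑' γ : YangBaxterSAW Θ Ω δ a b, ENNReal.ofReal (γ.weight Θ * x ^ (γ.length Θ)) := by
  rw [ybWeight, Measure.sum_apply _ MeasurableSet.univ]
  simp

/-- At `x = 1` the total weight is the two-point function `G_{Ω_δ}(a, b)` of `YangBaxterSAW.lean`.
[cite: GlazmanManolescu2019, §1] -/
theorem ybWeight_univ_one (Θ : ℤ → ℝ) (Ω : Set ℂ) (δ : ℝ) (a b : MidEdge) :
    ybWeight Θ Ω δ 1 a b Set.univ = twoPoint (meshFaces Θ Ω δ) Θ a b := by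
  rw [ybWeight_univ, twoPoint]
  simp

/-- The trivial walk gives `Z ≥ 1` when `a = b`. [folklore] -/
theorem one_le_ybWeight_univ_self (Θ : ℤ → ℝ) (Ω : Set ℂ) (δ x : ℝ) (a : MidEdge) :
    1 ≤ ybWeight Θ Ω δ x a a Set.univ := by
  rw [ybWeight_univ]
  calc (1 : ℝ≥0∞) = ENNReal.ofReal ((YBWalk.trivial a : YangBaxterSAW Θ Ω δ a a).weight Θ *
      x ^ ((YBWalk.trivial a : YangBaxterSAW Θ Ω δ a a).length Θ)) := by simp
    _ ≤ _ := ENNReal.le_tsum (YBWalk.trivial a)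

/-- When the partition function is neither `0` nor `∞` (e.g. bounded `Ω`, `δ > 0`, and some walk
of positive weight), `ybLaw` is a probability measure. [folklore] -/
theorem isProbabilityMeasure_ybLaw {Θ : ℤ → ℝ} {Ω : Set ℂ} {δ x : ℝ} {a b : MidEdge}
    (h0 : ybWeight Θ Ω δ x a b Set.univ ≠ 0) (htop : ybWeight Θ Ω δ x a b Set.univ ≠ ⊤) :
    IsProbabilityMeasure (ybLaw Θ Ω δ x a b) :=
  ⟨by rw [ybLaw, Measure.smul_apply, smul_eq_mul, ENNReal.inv_mul_cancel h0 htop]⟩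

end Literature.Probability.RandomPlanarGeometry.SAW.YangBaxter
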